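import Summits.CriticalPhenomena.PercolationContinuityZ3.Theorems.Transplant.SkelFrmFrom1Closure
import Summits.CriticalPhenomena.PercolationContinuityZ3.Theorems.Transplant.SkelFrmFrom1ClosurePx
import Summits.CriticalPhenomena.PercolationContinuityZ3.Theorems.Transplant.PlanarSkeletonFrmQuasi1
import Summits.CriticalPhenomena.PercolationContinuityZ3.Theorems.Transplant.PlanarSkeletonFrmQuasiDefs
import Summits.CriticalPhenomena.PercolationContinuityZ3.Theorems.Transplant.SkelPhiStepIFrQFromQ
import HarnessLib

/-!
# GEN-Q PORT (WAVE-Q table v0.8 section 2, row G244, U-level ?; captain R-6/R-7 2026-08-27: carrier token swap `PlanarSkeletonFrmFrom ↦ PlanarSkeletonFrmQuasi`)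
# of the tree module «Transplant/SkelFrmFrom1ClosurePx» (sha256 39f5a288cdd66b77…) onto the quasi-step carrier `PlanarSkeletonFrmQuasi` (p507026): «SkelFrmQuasi1ClosurePx»

ORIGINAL TITLE: 

builds on p205010 (kernel theorem, internal audit signed; external expert review pending) — nothing in this file uses p205010; NOTHING is claimed about any open node
((N3-b), the end state).  Lane `prim-bschramm`, seat `prim-bschramm-gen-1` (gen 4; binder-wave captain).  Helper file (`--supports stmt-CriticalPhenomena-4575 --as helper`).
PORT RULES (U-wave r1–r4 re-used, GEN-Q hunk classes of p3-g29 #6136): declaration order, names and proof texts are those of «SkelFrmFrom1ClosurePx», byte-identical except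
(i) the carrier token `PlanarSkeletonFrmFrom ↦ PlanarSkeletonFrmQuasi` in binders, `namespace`/`end` lines and qualified names (module names `SkelFrmFrom… ↦ SkelFrmQuasi…`
in imports of already-ported rows); (ii) `Φ.step ↦ Φ.qstep` with the called Steps lemma replaced by its `…Q`/`_q` twin and the cost `Φ.M` threaded — HERE: the Step-I‴ call `Skelφ.StepI.exists_stepI_frQ_indexP_from … Φ.step … Φ.cyl_connected ↦ Skelφ.StepI.exists_stepI_frQ_indexP_reach_q … Φ.qstep … Φ.cyl_reach` (Q09 «SkelPhiStepIFrQFromQ» p513864; (κ′) ↦ (κ″), `Steps ↦ QStepsN Φ.M`); (iii) `Φ.cyl_connected ↦ Φ.cyl_reach`: HERE, same call; (iv) graph-ball radii / window floors ×`Φ.M` (none unless listed).  Carrier-free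
residents stay imported/exported from the original «SkelFrm1ClosurePx» exactly as in the FrmFrom port.  Docstrings and citations are the original's.

-/

noncomputable section

open MeasureTheory ProbabilityTheory
open scoped ENNReal Classical

namespace Summit.CriticalPhenomena.PercolationContinuityZ3.Theorems.Transplant

open Literature.Probability.Percolation Literature.Probability.LatticeModels SimpleGraph KNLevels
open Literature.Barriers.CriticalPhenomena (HasExponentialGrowth)

/-! ## §1 The base type's sub-family of the quadrant index set -/

namespace Skelφ.StepI

variable {V : Type}

-- GEN-Q: carrier-free resident `Skelφ.StepI.indexNQ_mono_types` lives in the FrmFrom module (same namespace) — not re-declared.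

end Skelφ.StepI

/-! ## §2 The closure base with proxies -/

namespace PlanarSkeletonFrmQuasi

variable {V : Type} {G : SimpleGraph V} [G.LocallyFinite]

/-- **THE CLOSURE BASE AT ONE BASE TYPE (multi-type carrier).**  Let `Φ : PlanarSkeletonFrmQuasi G`, `t ∈ Φ.types` a base vertex, `D` a seed-floor shift (the proxies' radius in
U_s), `0 < p < 1` with a.s. uniqueness, Φ2 (`hC`) and `θ_t(p) > 0`.  Suppose the instance (`hB`) names `0 < δI < 1` and `m₀`; receives the
Step-I‴ output — records `D₀`, `DT`, quadrants `qd`, `qdT`, orientation `ori` — with its facts (`max m₀ D ≤ k`, `1 ≤ k ≤ M₀`, `R = ψ`, `Λ = fatSeq`, shared fields, geometric clause +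
shear bound at `t`); returns admissible `Sz`, `SMn`; and proves `θ_t(q) > 0` at every `q ∈ [p/2, p]` where the ORIENTED family over `indexNQ {t} Sz SMn (sgQ qd qdT ori)` holds with
accuracy `δI` and Φ2 holds.  Then some `q < p` has `θ_t(q) > 0`.  (The U closure base is the case `types = {t}`, `D = 0`.)
[cite: KozmaNitzan2024, §1 p. 2 (approach 1); §4 Theorem 6 (pp. 25–31), p. 17] [cite: MartineauTassion2017, §3.3 Lemma 3.7] -/
theorem drop_of_stepI_frQ_at [DecidableEq V] [Countable V] (Φ : PlanarSkeletonFrmQuasi G) {t : V} (ht : t ∈ Φ.types) (D : ℕ)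
    (p : unitInterval) (hp0 : 0 < (p : ℝ)) (hp1 : (p : ℝ) < 1) (hU : ∀ᵐ ω ∂bondPercolation G p, numInfiniteClusters ω ≤ 1) (hC : Φ.CylSubcritical p)
    (hθ : 0 < theta G t p)
    (hB : ∃ (δI : ℝ) (m₀ : ℕ), 0 < δI ∧ δI < 1 ∧
      ∀ (D₀ DT : Skelφ.StepI.DataN V) (qd qdT : V → ℕ → ℕ → ℤˣ × ℤˣ) (ori : V → ℕ → ℕ → Bool),
        max m₀ D ≤ D₀.k → 1 ≤ D₀.k → D₀.k ≤ D₀.M₀ → D₀.R = Skelφ.fatRadius Φ.frame hC → D₀.Λ = Skelφ.fatSeq Φ.frame hC →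
        DT.Λ = D₀.Λ → DT.k = D₀.k → DT.R = D₀.R → DT.M₀ = D₀.M₀ → DT.n₁ = D₀.n₁ →
        (∀ M, D₀.M₀ ≤ M → ∀ n, D₀.n₁ M ≤ n →
          (ori t M n = true → D₀.EqGeom G Φ.φ t M n ∧ (D₀.hgt t M n).natAbs ≤ 10 * n) ∧
          (ori t M n = false → DT.EqGeom G (Skelφ.trφ Φ.φ) t M n ∧ (DT.hgt t M n).natAbs ≤ 10 * n)) →
        ∃ (Sz : Finset ℕ) (SMn : Finset (ℕ × ℕ)), (∀ M ∈ Sz, D₀.M₀ ≤ M) ∧ (∀ q ∈ SMn, D₀.M₀ ≤ q.1 ∧ D₀.n₁ q.1 ≤ q.2) ∧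
          ∀ q : unitInterval, (p : ℝ) / 2 ≤ q → (q : ℝ) ≤ p →
            (∀ i ∈ Skelφ.StepI.indexNQ {t} Sz SMn (Skelφ.StepI.sgQ qd qdT ori),
              1 - δI < (bondPercolation G q).real (Skelφ.StepI.eventO G Φ.φ D₀ DT ori i)) →
            Φ.CylSubcritical q → 0 < theta G t q) :
    ∃ q : unitInterval, (q : ℝ) < p ∧ 0 < theta G t q := by
  obtain ⟨δI, m₀, hδI, hδI1, hB⟩ := hB
  have hC' : Skelφ.CylSubcritical G Φ.φ Φ.types p := hC
  -- Step I‴ under (κ″) and quasi-steps (p3-g29's «SkelPhiStepIFrQFromQ»), multi-type, seed floor `max m₀ D`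
  obtain ⟨D₀, DT, qd, qdT, ori, hk₀, hk₁, hkM, hR, hΛ, e1, e2, e3, e4, e5, hgeom, hfam⟩ :=
    Skelφ.StepI.exists_stepI_frQ_indexP_reach_q (types := Φ.types) (Φ.graph_connected t).preconnected Φ.lip Φ.qstep Φ.frame
      Φ.cyl_reach hC' hp0 hp1 hU hθ hδI hδI1 (max m₀ D)
  obtain ⟨Sz, SMn, hSz, hSMn, hq⟩ := hB D₀ DT qd qdT ori hk₀ hk₁ hkM hR hΛ e1 e2 e3 e4 e5 (fun M hM n hn => hgeom t ht M hM n hn)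
  -- the base type's sub-family of the oriented Step-I‴ family over all types
  have hfam' : ∀ i ∈ Skelφ.StepI.indexNQ {t} Sz SMn (Skelφ.StepI.sgQ qd qdT ori), 1 - δI < (bondPercolation G p).real (Skelφ.StepI.eventO G Φ.φ D₀ DT ori i) :=
    fun i hi => hfam Sz SMn hSz hSMn i (Skelφ.StepI.indexNQ_mono_types (Finset.singleton_subset_iff.2 ht) Sz SMn _ hi)
  exact Skelφ.exists_drop_of_inputs_theta' (φ := Φ.φ) (types := Φ.types) t hp0 hC'
    (Skelφ.StepI.indexNQ {t} Sz SMn (Skelφ.StepI.sgQ qd qdT ori)) (Skelφ.StepI.eventO G Φ.φ D₀ DT ori) (Skelφ.StepI.edgesO G Φ.φ D₀ DT ori)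
    (fun _ => 1 - δI) (fun i _ => Skelφ.StepI.determinedBy_eventO G Φ.φ D₀ DT ori i) hfam'
    fun q hq1 hq2 hcq hCq => hq q hq1 hq2 hcq hCq

end PlanarSkeletonFrmQuasi

end Summit.CriticalPhenomena.PercolationContinuityZ3.Theorems.Transplant

end
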